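import Literature.Probability.Exchangeability.Exchangeable
import HarnessLib

/-!
# Block averages of an exchangeable sequence: the `L²` computation

For a bounded measurable `f : E → ℝ` and a finite set `s` of coordinates, the block average
`blockAvg s f x = |s|⁻¹ ∑_{i ∈ s} f (x i)`.  Under an exchangeable law `P` all pair correlations
`∫ f (x i) f (x j) dP` (`i ≠ j`) coincide (`= c`) and all `∫ f (x i)² dP` coincide (`= d`), which
gives the closed form
`∫ blockAvg s f · blockAvg t f dP = |s ∩ t| / (|s| |t|) · (d - c) + c`
and hence, for `s ⊆ t`, `∫ (blockAvg s f - blockAvg t f)² dP = (|s|⁻¹ - |t|⁻¹)(d - c) ≤ 2M²/|s|`: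
block averages over growing blocks form a Cauchy sequence in `L²(P)`.  This is the quantitative
heart of the `L²` proof of de Finetti's theorem (it replaces the mean ergodic theorem behind
Kallenberg's Lemma 11.9).

## References

* O. Kallenberg, *Foundations of Modern Probability*, 2nd ed. (2002), Lemma 11.9, Thm 11.10.
  [Kallenberg2002]
-/

namespace Literature.Probability.Exchangeability

open _root_.MeasureTheory Equiv Function Set Finset Filter

variable {E : Type*}

/-- A block average of a function bounded by `M` is bounded by `M`. [folklore] -/
theorem abs_blockAvg_le {f : E → ℝ} {M : ℝ} (hM : ∀ z, |f z| ≤ M) (hM0 : 0 ≤ M) (s : Finset ℕ)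
    (x : ℕ → E) : |blockAvg s f x| ≤ M := by
  unfold blockAvg
  rcases s.eq_empty_or_nonempty with rfl | hs
  · simp [hM0]
  · have hc : (0 : ℝ) < s.card := by exact_mod_cast hs.card_pos
    rw [abs_mul, abs_inv, Nat.abs_cast]
    calc (s.card : ℝ)⁻¹ * |∑ i ∈ s, f (x i)|
        ≤ (s.card : ℝ)⁻¹ * ∑ i ∈ s, |f (x i)| := by
          gcongr; exact Finset.abs_sum_le_sum_abs _ _
      _ ≤ (s.card : ℝ)⁻¹ * ∑ _i ∈ s, M := by
          gcongr with i _
          exact hM _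
      _ = M := by
          rw [Finset.sum_const, nsmul_eq_mul]
          field_simp

/-- Reindexing a block average by a permutation of the coordinates. [folklore] -/
theorem blockAvg_comp_perm (s : Finset ℕ) (f : E → ℝ) (σ : Perm ℕ) (x : ℕ → E) :
    blockAvg s f (x ∘ σ) = blockAvg (s.map σ.toEmbedding) f x := by
  simp [blockAvg, Finset.sum_map]

/-- A permutation fixing every `n ≥ N` maps `{0, …, N-1}` onto itself. [folklore] -/
theorem map_range_eq_of_apply_eq_self {σ : Perm ℕ} {N : ℕ} (hσ : ∀ n, N ≤ n → σ n = n) :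
    (Finset.range N).map σ.toEmbedding = Finset.range N := by
  apply Finset.eq_of_subset_of_card_le
  · intro j hj
    rw [Finset.mem_map] at hj
    obtain ⟨n, hn, rfl⟩ := hj
    simp only [Equiv.toEmbedding_apply, Finset.mem_range] at hn ⊢
    by_contra hge
    push Not at hge
    have h1 : σ (σ n) = σ n := hσ _ hge
    have h2 : σ n = n := σ.injective h1
    omega
  · simp

/-- Block averages over an initial segment are invariant under permutations supported in that
segment. [folklore] -/
theorem blockAvg_range_comp_perm {σ : Perm ℕ} {N : ℕ} (hσ : ∀ n, N ≤ n → σ n = n) (f : E → ℝ)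
    (x : ℕ → E) : blockAvg (Finset.range N) f (x ∘ σ) = blockAvg (Finset.range N) f x := by
  rw [blockAvg_comp_perm, map_range_eq_of_apply_eq_self hσ]

variable [MeasurableSpace E]

/-- A measurable function bounded by `M` on a finite measure space is integrable. [folklore] -/
theorem integrable_of_abs_le {P : Measure (ℕ → E)} [IsFiniteMeasure P] {g : (ℕ → E) → ℝ}
    (hg : Measurable g) {M : ℝ} (hM : ∀ x, |g x| ≤ M) : Integrable g P :=
  (integrable_const M).mono' hg.aestronglyMeasurable
    (Eventually.of_forall fun x => by simpa [Real.norm_eq_abs] using hM x)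

namespace IsExchangeable

variable {P : Measure (ℕ → E)}

/-- Under an exchangeable law every coordinate has the law of the first:
`∫ F (x i) dP = ∫ F (x 0) dP`. [cite: Kallenberg2002, Ch. 11, eq. (6)] -/
theorem integral_eval_eq {G : Type*} [NormedAddCommGroup G] [NormedSpace ℝ G]
    (h : IsExchangeable P) (F : E → G) (i : ℕ) : ∫ x, F (x i) ∂P = ∫ x, F (x 0) ∂P := by
  have := h.integral_sample_eq (k := 1) (fun _ => i) (fun a b _ => Subsingleton.elim a b)
    (fun y => F (y 0))
  simpa using this

/-- Under an exchangeable law every pair of distinct coordinates has the law of the first two: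
`∫ F (x i) G (x j) dP = ∫ F (x 0) G (x 1) dP` for `i ≠ j`.
[cite: Kallenberg2002, Ch. 11, eq. (6)] -/
theorem integral_eval_mul_eval_eq (h : IsExchangeable P) (F G : E → ℝ) {i j : ℕ} (hij : i ≠ j) :
    ∫ x, F (x i) * G (x j) ∂P = ∫ x, F (x 0) * G (x 1) ∂P := by
  have hinj : Injective ![i, j] := by
    intro a b hab
    fin_cases a <;> fin_cases b
    · rfl
    · exact absurd hab (by simpa using hij)
    · exact absurd hab (by simpa using hij.symm)
    · rfl
  have := h.integral_sample_eq ![i, j] hinj (fun y => F (y 0) * G (y 1))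
  simpa using this

/-- Pair integrals `∫ f (x i) f (x j) dP` of an exchangeable law take only two values: the
diagonal one `d = ∫ f (x 0)² dP` and the off-diagonal one `c = ∫ f (x 0) f (x 1) dP`. [folklore] -/
theorem integral_eval_mul_eval_eq_ite (h : IsExchangeable P) (f : E → ℝ) (i j : ℕ) :
    ∫ x, f (x i) * f (x j) ∂P =
      if i = j then ∫ x, f (x 0) ^ 2 ∂P else ∫ x, f (x 0) * f (x 1) ∂P := by
  split_ifs with hij
  · subst hij
    rw [h.integral_eval_eq (fun z => f z * f z) i]
    simp [sq]
  · exact h.integral_eval_mul_eval_eq f f hij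

variable [IsProbabilityMeasure P]

/-- **Correlation of two block averages** under an exchangeable law:
`∫ blockAvg s f · blockAvg t f dP = |s ∩ t| / (|s|·|t|) · (d - c) + c` with
`d = ∫ f (x 0)² dP`, `c = ∫ f (x 0) f (x 1) dP`. [folklore] -/
theorem integral_blockAvg_mul_blockAvg (h : IsExchangeable P) {f : E → ℝ} (hf : Measurable f)
    {M : ℝ} (hM : ∀ z, |f z| ≤ M) {s t : Finset ℕ} (hs : s.Nonempty) (ht : t.Nonempty) :
    ∫ x, blockAvg s f x * blockAvg t f x ∂P =
      ((s ∩ t).card : ℝ) / ((s.card : ℝ) * t.card) *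
          (∫ x, f (x 0) ^ 2 ∂P - ∫ x, f (x 0) * f (x 1) ∂P) + ∫ x, f (x 0) * f (x 1) ∂P := by
  classical
  have hsc : (s.card : ℝ) ≠ 0 := by exact_mod_cast hs.card_pos.ne'
  have htc : (t.card : ℝ) ≠ 0 := by exact_mod_cast ht.card_pos.ne'
  have hint : ∀ i j : ℕ, Integrable (fun x : ℕ → E => f (x i) * f (x j)) P := by
    intro i j
    refine integrable_of_abs_le ((hf.comp (measurable_pi_apply i)).mul
      (hf.comp (measurable_pi_apply j))) (M := M * M) fun x => ?_
    rw [abs_mul]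
    exact mul_le_mul (hM (x i)) (hM (x j)) (abs_nonneg _)
      ((abs_nonneg (f (x i))).trans (hM (x i)))
  have hexp : ∀ x : ℕ → E, blockAvg s f x * blockAvg t f x =
      ((s.card : ℝ)⁻¹ * (t.card : ℝ)⁻¹) * ∑ i ∈ s, ∑ j ∈ t, f (x i) * f (x j) := by
    intro x
    rw [blockAvg, blockAvg, mul_mul_mul_comm, Finset.sum_mul_sum]
  simp_rw [hexp]
  rw [integral_const_mul,
    integral_finsetSum _ (fun i _ => integrable_finsetSum _ fun j _ => hint i j)]
  simp_rw [integral_finsetSum _ (fun j _ => hint _ j)]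
  rw [Finset.sum_congr rfl fun i _ =>
    Finset.sum_congr rfl fun j _ => h.integral_eval_mul_eval_eq_ite f i j]
  generalize ∫ x, f (x 0) ^ 2 ∂P = d
  generalize ∫ x, f (x 0) * f (x 1) ∂P = c
  have hsum : ∑ i ∈ s, ∑ j ∈ t, (if i = j then d else c) =
      ((s ∩ t).card : ℝ) * (d - c) + (s.card : ℝ) * t.card * c := by
    have : ∀ i j : ℕ, (if i = j then d else c) = c + if i = j then d - c else 0 := by
      intro i j; split_ifs <;> ring
    simp_rw [this, Finset.sum_add_distrib, Finset.sum_const, Finset.sum_ite_eq,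
      nsmul_eq_mul]
    rw [Finset.sum_ite_mem, Finset.sum_const, nsmul_eq_mul]
    ring
  rw [hsum]
  field_simp

/-- **`L²` increments of block averages**: for `s ⊆ t`,
`∫ (blockAvg s f - blockAvg t f)² dP = (|s|⁻¹ - |t|⁻¹) (d - c)`. [folklore] -/
theorem integral_blockAvg_sub_sq (h : IsExchangeable P) {f : E → ℝ} (hf : Measurable f)
    {M : ℝ} (hM : ∀ z, |f z| ≤ M) {s t : Finset ℕ} (hst : s ⊆ t) (hs : s.Nonempty) :
    ∫ x, (blockAvg s f x - blockAvg t f x) ^ 2 ∂P =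
      ((s.card : ℝ)⁻¹ - (t.card : ℝ)⁻¹) *
        (∫ x, f (x 0) ^ 2 ∂P - ∫ x, f (x 0) * f (x 1) ∂P) := by
  have ht : t.Nonempty := hs.mono hst
  obtain ⟨x₀⟩ := nonempty_of_isProbabilityMeasure P
  have hM0 : 0 ≤ M := (abs_nonneg _).trans (hM (x₀ 0))
  have hsc : (s.card : ℝ) ≠ 0 := by exact_mod_cast hs.card_pos.ne'
  have htc : (t.card : ℝ) ≠ 0 := by exact_mod_cast ht.card_pos.ne'
  have hint : ∀ s' t' : Finset ℕ,
      Integrable (fun x : ℕ → E => blockAvg s' f x * blockAvg t' f x) P := by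
    intro s' t'
    refine integrable_of_abs_le ((measurable_blockAvg s' hf).mul (measurable_blockAvg t' hf))
      (M := M * M) fun x => ?_
    rw [abs_mul]
    exact mul_le_mul (abs_blockAvg_le hM hM0 _ _) (abs_blockAvg_le hM hM0 _ _) (abs_nonneg _)
      hM0
  have hA : Integrable (fun x : ℕ → E =>
      blockAvg s f x * blockAvg s f x - 2 * (blockAvg s f x * blockAvg t f x)) P :=
    (hint s s).sub ((hint s t).const_mul 2)
  have hB : Integrable (fun x : ℕ → E => 2 * (blockAvg s f x * blockAvg t f x)) P :=
    (hint s t).const_mul 2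
  have hexp : ∀ x : ℕ → E, (blockAvg s f x - blockAvg t f x) ^ 2 =
      blockAvg s f x * blockAvg s f x - 2 * (blockAvg s f x * blockAvg t f x) +
        blockAvg t f x * blockAvg t f x := by
    intro x; ring
  simp_rw [hexp]
  rw [integral_add hA (hint t t), integral_sub (hint s s) hB, integral_const_mul,
    h.integral_blockAvg_mul_blockAvg hf hM hs hs, h.integral_blockAvg_mul_blockAvg hf hM hs ht,
    h.integral_blockAvg_mul_blockAvg hf hM ht ht, Finset.inter_self, Finset.inter_self,
    Finset.inter_eq_left.mpr hst]
  field_simp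
  ring

/-- Second moments of a function bounded by `M` are bounded by `M²` (probability measure).
[folklore] -/
theorem abs_integral_mul_le {f : E → ℝ} {M : ℝ} (hM : ∀ z, |f z| ≤ M) (i j : ℕ) :
    |∫ x, f (x i) * f (x j) ∂P| ≤ M ^ 2 := by
  refine abs_integral_le_integral_abs.trans ?_
  calc ∫ x, |f (x i) * f (x j)| ∂P ≤ ∫ _x, M ^ 2 ∂P := by
        refine integral_mono_of_nonneg (Eventually.of_forall fun _ => abs_nonneg _)
          (integrable_const _) (Eventually.of_forall fun x => ?_)
        dsimp only
        rw [abs_mul, sq]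
        exact mul_le_mul (hM _) (hM _) (abs_nonneg _) ((abs_nonneg _).trans (hM (x i)))
    _ = M ^ 2 := by simp

/-- The `L²` increment bound `∫ (blockAvg s f - blockAvg t f)² dP ≤ 2 M² / |s|` for `s ⊆ t`
and `|f| ≤ M`. [folklore] -/
theorem integral_blockAvg_sub_sq_le (h : IsExchangeable P) {f : E → ℝ} (hf : Measurable f)
    {M : ℝ} (hM : ∀ z, |f z| ≤ M) {s t : Finset ℕ} (hst : s ⊆ t) (hs : s.Nonempty) :
    ∫ x, (blockAvg s f x - blockAvg t f x) ^ 2 ∂P ≤ 2 * M ^ 2 * (s.card : ℝ)⁻¹ := by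
  rw [h.integral_blockAvg_sub_sq hf hM hst hs]
  have h1 : 0 ≤ (s.card : ℝ)⁻¹ - (t.card : ℝ)⁻¹ := by
    rw [sub_nonneg]
    exact inv_anti₀ (by exact_mod_cast hs.card_pos) (by exact_mod_cast Finset.card_le_card hst)
  have h2 : (s.card : ℝ)⁻¹ - (t.card : ℝ)⁻¹ ≤ (s.card : ℝ)⁻¹ := by
    simp only [sub_le_self_iff, inv_nonneg]
    positivity
  have hd : |∫ x, f (x 0) ^ 2 ∂P| ≤ M ^ 2 := by
    have := abs_integral_mul_le (P := P) hM 0 0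
    simpa [sq] using this
  have hc : |∫ x, f (x 0) * f (x 1) ∂P| ≤ M ^ 2 := abs_integral_mul_le hM 0 1
  have hdc : |∫ x, f (x 0) ^ 2 ∂P - ∫ x, f (x 0) * f (x 1) ∂P| ≤ 2 * M ^ 2 := by
    refine (abs_sub _ _).trans ?_
    linarith
  calc ((s.card : ℝ)⁻¹ - (t.card : ℝ)⁻¹) * (∫ x, f (x 0) ^ 2 ∂P - ∫ x, f (x 0) * f (x 1) ∂P)
      ≤ ((s.card : ℝ)⁻¹ - (t.card : ℝ)⁻¹) * (2 * M ^ 2) :=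
        mul_le_mul_of_nonneg_left ((le_abs_self _).trans hdc) h1
    _ ≤ (s.card : ℝ)⁻¹ * (2 * M ^ 2) := mul_le_mul_of_nonneg_right h2 (by positivity)
    _ = 2 * M ^ 2 * (s.card : ℝ)⁻¹ := by ring

end IsExchangeable

end Literature.Probability.Exchangeability
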